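import Summits.CriticalPhenomena.Ising3DConformalLimit.Theses.MirrorHoelderCompactness
import Summits.CriticalPhenomena.Ising3DConformalLimit.Theorems.ExistsScaleCovariantLimit.Negative.TightnessUniqueness
import HarnessLib

/-!
# Route `MirrorHoelderCompactness` — item `LimitConstruction` (stmt-CriticalPhenomena-6159)

`LimitConstruction : UniformRegularity → PointwiseLimit → ExistsScaleCovariantLimit` (GLUE 2 of the
route; antecedent = item stmt-CriticalPhenomena-4658 verbatim, conclusion = item stmt-CriticalPhenomena-1981
verbatim), proved unconditionally.

Proof. Only clause (b) of `UniformRegularity` (asymptotic uniform equicontinuity of the rescaled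
critical correlators `F_n^δ = rescaledCorrelator (criticalCorr 3) ρ★ n δ` on compact sets of
non-coincident configurations) and `PointwiseLimit` (pointwise convergence of `F_n^δ(x)` as `δ → 0⁺`)
are used:
* `tendstoUniformlyOn_of_equicontinuous` — the elementary real-analysis step: on a compact set,
  pointwise convergence along a filter plus asymptotic uniform equicontinuity give uniform convergence
  (finite `r`-net, `ε/3` argument; the limit inherits the modulus);
* `exists_hasPointwiseScalingLimit_of_equicontinuous` — hence, `NonCoincident 3 n` being open in the
  locally compact configuration space, the pointwise limits `S n x` form a pointwise scaling limit
  (`HasPointwiseScalingLimit`, i.e. locally uniform convergence off the diagonals) for the forced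
  renormalisation `ρ★(δ) = ⟨σ₀σ_{⌊δ⁻¹⌋e₀}⟩^{-1/2}`, which is the tree's pinned renormalisation `rhoPin`;
* the landed structural theorem `ExistsScaleCovariantLimitNegative.crux_of_pinnedLimit`
  (`Theorems/ExistsScaleCovariantLimit/Negative/TightnessUniqueness.lean`): a full-filter limit of the
  PINNED zoom is already the crux — positivity of `ρ★` on `(0,1]`, normalisation off `NonCoincident`,
  non-degeneracy (`S₂(0,e₀) = 1`), translation invariance, exact scale covariance and `Δ ≥ 1/2 > 0`
  are theorems of the tree for any such limit.

References: the statement shape is Chelkak–Hongler–Izyurov, Ann. Math. 181 (2015), Thm 1.1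
transposed to `ℝ³`; the analysis is folklore (Arzelà–Ascoli without extraction).
-/

noncomputable section

namespace Summit.CriticalPhenomena.Ising3DConformalLimit.MirrorHoelderLimitConstruction

open Literature.Probability.LatticeModels Filter Set
open scoped Topology
open Summit.CriticalPhenomena.Ising3DConformalLimit.MoebiusLimitExistsOnlyInteraction (rhoPin)

/-- **Pointwise convergence + asymptotic uniform equicontinuity ⟹ uniform convergence on a compact
set.** If real functions `F i` converge pointwise on a compact `K` along a filter `p` to `f`, and for
every `ε > 0` there is `r > 0` such that, eventually along `p`, `|F i x − F i y| < ε` whenever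
`x, y ∈ K` are `r`-close, then `F i → f` uniformly on `K` (and `f` inherits the modulus). [folklore] -/
theorem tendstoUniformlyOn_of_equicontinuous {X ι : Type*} [PseudoMetricSpace X] {p : Filter ι}
    [p.NeBot] {F : ι → X → ℝ} {f : X → ℝ} {K : Set X} (hK : IsCompact K)
    (hequi : ∀ ε : ℝ, 0 < ε → ∃ r : ℝ, 0 < r ∧
      ∀ᶠ i in p, ∀ x ∈ K, ∀ y ∈ K, dist x y < r → dist (F i x) (F i y) < ε)
    (hpt : ∀ x ∈ K, Tendsto (fun i => F i x) p (𝓝 (f x))) :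
    TendstoUniformlyOn F f p K := by
  rw [Metric.tendstoUniformlyOn_iff]
  intro ε hε
  obtain ⟨r, hr, hev⟩ := hequi (ε / 3) (by positivity)
  obtain ⟨t, htK, htf, hcov⟩ := hK.finite_cover_balls hr
  -- the limit inherits the modulus of continuity
  have hlim : ∀ x ∈ K, ∀ y ∈ K, dist x y < r → dist (f x) (f y) ≤ ε / 3 := by
    intro x hx y hy hxy
    exact le_of_tendsto ((hpt x hx).dist (hpt y hy))
      (hev.mono fun i hi => (hi x hx y hy hxy).le)
  -- convergence at the finitely many centres
  have hcen : ∀ᶠ i in p, ∀ x ∈ t, dist (F i x) (f x) < ε / 3 := by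
    rw [htf.eventually_all]
    intro x hx
    exact Metric.tendsto_nhds.1 (hpt x (htK hx)) (ε / 3) (by positivity)
  filter_upwards [hev, hcen] with i hi hci y hy
  obtain ⟨x, hxt, hyx⟩ := Set.mem_iUnion₂.1 (hcov hy)
  rw [Metric.mem_ball] at hyx
  have hxK : x ∈ K := htK hxt
  have h1 : dist (f y) (f x) ≤ ε / 3 := hlim y hy x hxK hyx
  have h2 : dist (f x) (F i x) < ε / 3 := by rw [dist_comm]; exact hci x hxt
  have h3 : dist (F i x) (F i y) < ε / 3 := hi x hxK y hy (by rwa [dist_comm])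
  calc dist (f y) (F i y) ≤ dist (f y) (f x) + dist (f x) (F i x) + dist (F i x) (F i y) :=
        dist_triangle4 _ _ _ _
    _ < ε / 3 + ε / 3 + ε / 3 := by linarith
    _ = ε := by ring

/-- **Equicontinuity + pointwise limits ⟹ a pointwise scaling limit.** For any lattice family `G` on
`ℤ^d` and renormalisation `ρ`: if the rescaled correlators are asymptotically uniformly equicontinuous
on every compact set of non-coincident configurations (clause (b) of `UniformRegularity`) and converge
pointwise as `δ → 0⁺` at every non-coincident configuration, then the pointwise limits `S` satisfy
`HasPointwiseScalingLimit G ρ S` (locally uniform convergence off the diagonals: `NonCoincident d n` is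
open in the locally compact configuration space, so it suffices to converge uniformly on its compact
subsets). [folklore] -/
theorem exists_hasPointwiseScalingLimit_of_equicontinuous {d : ℕ} (G : LatticeCorrFamily d)
    (ρ : ℝ → ℝ)
    (hEq : ∀ (n : ℕ) (K : Set (Fin n → EuclideanSpace ℝ (Fin d))), K ⊆ NonCoincident d n →
      IsCompact K → ∀ ε : ℝ, 0 < ε → ∃ r δ₀ : ℝ, 0 < r ∧ 0 < δ₀ ∧ ∀ δ ∈ Set.Ioo 0 δ₀,
        ∀ x ∈ K, ∀ y ∈ K, dist x y < r →
          |rescaledCorrelator G ρ n δ x - rescaledCorrelator G ρ n δ y| < ε)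
    (hPL : ∀ n : ℕ, ∀ x ∈ NonCoincident d n, ∃ l : ℝ,
      Tendsto (fun δ : ℝ => rescaledCorrelator G ρ n δ x) (𝓝[>] (0 : ℝ)) (𝓝 l)) :
    ∃ S : CorrFamily d, HasPointwiseScalingLimit G ρ S := by
  choose! S hS using hPL
  refine ⟨S, fun n => ?_⟩
  rw [tendstoLocallyUniformlyOn_iff_forall_isCompact (isOpen_nonCoincident d n)]
  intro K hKs hK
  refine tendstoUniformlyOn_of_equicontinuous hK (fun ε hε => ?_) (fun x hx => hS n x (hKs hx))
  obtain ⟨r, δ₀, hr, hδ₀, h⟩ := hEq n K hKs hK ε hε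
  refine ⟨r, hr, ?_⟩
  filter_upwards [Ioo_mem_nhdsGT hδ₀] with δ hδ x hx y hy hxy
  rw [Real.dist_eq]
  exact h δ hδ x hx y hy hxy

/-- The forced renormalisation `ρ★(δ) = ⟨σ₀σ_{⌊δ⁻¹⌋e₀}⟩^{-1/2}` of items 4658 / 6153 / 6159 is the
tree's pinned renormalisation `rhoPin` (`δ⁻¹ = 1/δ`). [folklore] -/
theorem rhoStar_eq_rhoPin :
    (fun δ : ℝ => (criticalTwoPoint 3 (Pi.single 0 ⌊δ⁻¹⌋)) ^ (-(1 / 2 : ℝ))) = rhoPin := by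
  funext δ
  simp only [rhoPin, one_div]

/-- **Item stmt-CriticalPhenomena-6159 `LimitConstruction` (route `MirrorHoelderCompactness`),
unconditionally.** `UniformRegularity → PointwiseLimit → ExistsScaleCovariantLimit`: clause (b) of
`UniformRegularity` and `PointwiseLimit` give a full-filter pointwise scaling limit of the pinned zoom
(`exists_hasPointwiseScalingLimit_of_equicontinuous`, `ρ★ = rhoPin`), and every such limit is the
existence crux with all its clauses (`ExistsScaleCovariantLimitNegative.crux_of_pinnedLimit`).
[folklore] -/
theorem limitConstruction_proof :
    Summit.CriticalPhenomena.Ising3DConformalLimit.Theses.MirrorHoelderCompactness.LimitConstruction := by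
  intro hUR hPL
  obtain ⟨S, hS⟩ := exists_hasPointwiseScalingLimit_of_equicontinuous (criticalCorr 3)
    (fun δ : ℝ => (criticalTwoPoint 3 (Pi.single 0 ⌊δ⁻¹⌋)) ^ (-(1 / 2 : ℝ)))
    (fun n K hKs hK => (hUR.1 n K hKs hK).2) hPL
  have hS' : HasPointwiseScalingLimit (criticalCorr 3) rhoPin S := by
    rw [← rhoStar_eq_rhoPin]
    exact hS
  exact Summit.CriticalPhenomena.Ising3DConformalLimit.ExistsScaleCovariantLimitNegative.crux_of_pinnedLimit
    hS'

end Summit.CriticalPhenomena.Ising3DConformalLimit.MirrorHoelderLimitConstruction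

end
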